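import Literature.MathematicalPhysics.QuantumLattice.HubbardNNNHoppingLocalHamiltonian
import Summits.HubbardSuperconductivity.ManyBodyBootstrap.HubbardTorusCommutatorSharp
import HarnessLib

/-!
# Torus ceiling VII(a) — the `t–t'` torus commutator pull-back under the SHARP torus hypothesis
# (`x ↦ x mod L` injective on the window `Λ'` only)

HONEST FRAMING: first certified bounds; not a superconductivity verdict; every number certified or
labelled float.

The tree lemma `Literature.MathematicalPhysics.QuantumLattice.hubbardTorusTT'_commutator_fermionEmbed`
(`HubbardNNNHoppingLocalHamiltonian`) proves `[H^{tt'}_L, Γ A] = Γ([H^{tt'}_{Λ'}, A])` for an observable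
`A` of an inner region `Λ` with all eight king-move neighbours in the window (`thicken Λ 1 ⊆ Λ'`) under
the hypothesis that `x ↦ x mod L` is injective on the THICKENED window `thicken Λ' 1`; for a window of
coordinate spread `M` this costs `L ≥ M + 3`, so the tree's `t–t'` window-certificate transport
(`groundEnergy_hubbardTorusTT'_div_ge_of_window_certificate`) says nothing about the `3 × 3` / `4 × 4`
tori that realise the CAL ceiling caps of the window classes `(≤3,≤3)` / `(4,4)` at `t' ≠ 0`.

This file proves the same identity assuming injectivity on `Λ'` ONLY (`L ≥ M + 1`), by the per-bond
argument of pub-mbboot's `HubbardTorusCommutatorSharp` (nearest-neighbour bonds) run for the DIAGONAL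
bonds: when `x ↦ x mod L` is injective on `Λ'` but not on its thickening, the torus may contain
"wrap-around" diagonal bonds between image sites that are not images of lattice diagonal bonds; they are
collected in an extra far term
`W' = -t' Σ_{x,y ∈ Λ', x mod L ∼∼ y mod L, x ≁≁ y} Σ_σ c†_{x mod L,σ} c_{y mod L,σ}`
(`diagHamiltonian_eq_fermionEmbed_localHamiltonian_add_wrap`), and `W'` avoids the image of `Λ`
(`wrapDiag_hopping_mem_carEvenSubalgebra`): a diagonal torus neighbour of `x mod L`, `x ∈ Λ`, is
`(x ± (e₁ ± e₂)) mod L` with `x ± (e₁ ± e₂) ∈ Λ'`, hence — by injectivity on `Λ'` — a wrap-around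
partner `y ∈ Λ'` would equal `x ± (e₁ ± e₂)`, a lattice diagonal neighbour
(`diagAdj_of_fermionTorusDiagGraph_adj_proj`). With pub-mbboot's nearest-neighbour statement
(`hubbardTorus_sub_fermionEmbed_localHamiltonian_mem_carEvenSubalgebra_sharp`) this gives
`hubbardTorusTT'_commutator_fermionEmbed_sharp`: the tree identity with
`hInj : Set.InjOn (Torus.proj L) Λ'`. Consumed by `TorusCeilingTTPrimeSectors` (the `t–t'` torus
ceiling in every sector `(N↑, N↓)`, cal-3 kernel column K7).

No new mathematics beyond a sharpened hypothesis of a tree lemma (method: Bratteli–Robinson II §6.2.1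
local commutativity, as cited by the tree lemma). [cite: BratteliRobinsonII1997, §6.2.1]
[cite: Han2020Bootstrap, §3] [cite: XuEtAl2024, eq. (1)]
-/

noncomputable section

namespace Summit.Ventures.CertifiedManyBodySolver.Rows

open Matrix Finset
open Literature.MathematicalPhysics.QuantumLattice
open Literature.Probability.LatticeModels
open HubbardWave0
open Summit.HubbardSuperconductivity.ManyBodyBootstrap
open scoped ComplexOrder BigOperators

variable (L : ℕ) [NeZero L]

/-! ### Lattice diagonal bonds versus torus diagonal bonds under `x ↦ x mod L` injective on the window -/

section Bonds

/-- **Lattice diagonal neighbours in the window are torus diagonal neighbours**: for `y = x ± (e₁ ± e₂)`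
with `x, y ∈ Λ'` and `x ↦ x mod L` injective on `Λ'`, `x mod L ∼∼ y mod L` on the torus (the preserved
direction of `fermionTorusDiagGraph_adj_ofTorusSite_proj_iff`, which needs injectivity only for
`x mod L ≠ y mod L`). [cite: FriedliVelenik2017, §3.1] -/
theorem fermionTorusDiagGraph_adj_proj_of_diagAdj {Λ' : Finset (Site 2)}
    (hInj : Set.InjOn (Torus.proj (d := 2) L) ↑Λ') {x y : Site 2} (hx : x ∈ Λ') (hy : y ∈ Λ')
    (hxy : (∃ s : Fin 2, y = x + diagVec s) ∨ ∃ s : Fin 2, x = y + diagVec s) :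
    (fermionTorusDiagGraph L).Adj (FermionTorus.ofTorusSite (Torus.proj L x))
      (FermionTorus.ofTorusSite (Torus.proj L y)) := by
  have proj_add : ∀ x y : Site 2, Torus.proj L (x + y) = Torus.proj L x + Torus.proj L y := fun x y => by
    funext i; simp [Torus.proj]
  rw [fermionTorusDiagGraph_adj, FermionTorus.toTorusSite_ofTorusSite, FermionTorus.toTorusSite_ofTorusSite,
    torusDiagGraph_adj_iff]
  refine ⟨fun h => ?_, ?_⟩
  · have hxy' : x = y := hInj hx hy h
    rcases hxy with ⟨s, hs⟩ | ⟨s, hs⟩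
    · exact self_ne_add_diagVec x s (hxy'.trans hs)
    · exact self_ne_add_diagVec y s (hxy'.symm.trans hs)
  · rcases hxy with ⟨s, hs⟩ | ⟨s, hs⟩
    · exact Or.inl ⟨s, by rw [hs, proj_add, proj_diagVec]⟩
    · exact Or.inr ⟨s, by rw [hs, proj_add, proj_diagVec]⟩

/-- **A diagonal torus bond at the image of the inner region comes from a lattice diagonal bond**: if
`x ∈ Λ`, all four diagonal neighbours of `x` lie in `Λ'`, `y ∈ Λ'`, `x ↦ x mod L` is injective on `Λ'`
and `x mod L ∼∼ y mod L` on the torus, then `y = x ± (e₁ ± e₂)` — the torus neighbour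
`y mod L = (x ± (e₁ ± e₂)) mod L` has the preimage `x ± (e₁ ± e₂) ∈ Λ'`. No hypothesis on the thickened
window. [cite: FriedliVelenik2017, §3.1] -/
theorem diagAdj_of_fermionTorusDiagGraph_adj_proj {Λ Λ' : Finset (Site 2)}
    (hclosedD : ∀ x ∈ Λ, ∀ s : Fin 2, x + diagVec s ∈ Λ' ∧ x - diagVec s ∈ Λ')
    (hInj : Set.InjOn (Torus.proj (d := 2) L) ↑Λ') {x y : Site 2} (hx : x ∈ Λ) (hy : y ∈ Λ')
    (hadj : (fermionTorusDiagGraph L).Adj (FermionTorus.ofTorusSite (Torus.proj L x))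
      (FermionTorus.ofTorusSite (Torus.proj L y))) :
    (∃ s : Fin 2, y = x + diagVec s) ∨ ∃ s : Fin 2, x = y + diagVec s := by
  have proj_add : ∀ x y : Site 2, Torus.proj L (x + y) = Torus.proj L x + Torus.proj L y := fun x y => by
    funext i; simp [Torus.proj]
  have proj_sub : ∀ x y : Site 2, Torus.proj L (x - y) = Torus.proj L x - Torus.proj L y := fun x y => by
    funext i; simp [Torus.proj]
  rw [fermionTorusDiagGraph_adj, FermionTorus.toTorusSite_ofTorusSite, FermionTorus.toTorusSite_ofTorusSite,
    torusDiagGraph_adj_iff] at hadj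
  obtain ⟨-, ⟨s, hs⟩ | ⟨s, hs⟩⟩ := hadj
  · -- `y mod L = x mod L + j_s = (x + j_s) mod L`, `x + j_s ∈ Λ'`
    refine Or.inl ⟨s, hInj hy (hclosedD x hx s).1 ?_⟩
    rw [hs, proj_add, proj_diagVec]
  · -- `x mod L = y mod L + j_s`, so `y mod L = (x - j_s) mod L`, `x - j_s ∈ Λ'`
    have hy' : y = x - diagVec s := hInj hy (hclosedD x hx s).2 (by
      rw [proj_sub, proj_diagVec, hs, add_sub_cancel_right])
    exact Or.inr ⟨s, by rw [hy']; exact (sub_add_cancel x _).symm⟩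

/-- **The wrap-around diagonal bonds avoid the image of the inner region**: the hopping terms of the
diagonal torus bonds `x mod L ∼∼ y mod L` between image sites of `Λ'` that are NOT images of lattice
diagonal bonds lie in the even CAR subalgebra of the orbitals away from the image of `Λ`, whenever every
diagonal neighbour of `Λ` is in `Λ'` and `x ↦ x mod L` is injective on `Λ'`.
[cite: BratteliRobinsonII1997, §5.2.2] -/
theorem wrapDiag_hopping_mem_carEvenSubalgebra {Λ Λ' : Finset (Site 2)} (hΛ : Λ ⊆ Λ')
    (hclosedD : ∀ x ∈ Λ, ∀ s : Fin 2, x + diagVec s ∈ Λ' ∧ x - diagVec s ∈ Λ')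
    (hInj : Set.InjOn (Torus.proj (d := 2) L) ↑Λ') :
    (∑ x ∈ Λ', ∑ y ∈ Λ',
        (if (fermionTorusDiagGraph L).Adj (FermionTorus.ofTorusSite (Torus.proj L x))
              (FermionTorus.ofTorusSite (Torus.proj L y)) ∧
              ¬((∃ s : Fin 2, y = x + diagVec s) ∨ ∃ s : Fin 2, x = y + diagVec s) then
          ∑ σ : Fin 2, creation (orb (FermionTorus.ofTorusSite (Torus.proj L x)) σ) *
            annihilation (orb (FermionTorus.ofTorusSite (Torus.proj L y)) σ)
        else 0)) ∈
      carEvenSubalgebra (orbs (Λ.image fun x => FermionTorus.ofTorusSite (Torus.proj L x)))ᶜ := by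
  refine sum_mem fun x hx => sum_mem fun y hy => ?_
  by_cases h : (fermionTorusDiagGraph L).Adj (FermionTorus.ofTorusSite (Torus.proj L x))
      (FermionTorus.ofTorusSite (Torus.proj L y)) ∧
      ¬((∃ s : Fin 2, y = x + diagVec s) ∨ ∃ s : Fin 2, x = y + diagVec s)
  · rw [if_pos h]
    have hxΛ : FermionTorus.ofTorusSite (Torus.proj L x) ∉
        Λ.image fun z => FermionTorus.ofTorusSite (Torus.proj L z) := fun hmem =>
      h.2 (diagAdj_of_fermionTorusDiagGraph_adj_proj L hclosedD hInj (mem_of_proj_mem_image L hΛ hInj hx hmem) hy h.1)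
    have hyΛ : FermionTorus.ofTorusSite (Torus.proj L y) ∉
        Λ.image fun z => FermionTorus.ofTorusSite (Torus.proj L z) := fun hmem =>
      h.2 (diagAdj_of_fermionTorusDiagGraph_adj_proj L hclosedD hInj (mem_of_proj_mem_image L hΛ hInj hy hmem) hx
        h.1.symm).symm
    exact sum_mem fun σ _ => creation_mul_annihilation_mem_carEvenSubalgebra
      (Finset.mem_compl.2 fun h' => hxΛ (orb_mem_orbs.1 h'))
      (Finset.mem_compl.2 fun h' => hyΛ (orb_mem_orbs.1 h'))
  · rw [if_neg h]
    exact zero_mem _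

end Bonds

/-! ### The decomposition `H^{t'}_L = Γ(H^{t'}_{Λ'}) + far + wrap-around` and the `t–t'` commutator -/

section Decomposition

variable (t t' U : ℝ)

/-- **`H^{t'}_L = Γ(H^{t'}_{Λ'}) + far terms + wrap-around diagonal bonds`**: for `x ↦ x mod L` injective
on `Λ'` (only), the diagonal hopping Hamiltonian of the torus is the embedded free-boundary local
Hamiltonian of the diagonal interaction on `Λ'` plus the hopping terms of the diagonal torus bonds not
inside the image `I'` of `Λ'`, plus the hopping terms of the diagonal torus bonds inside `I'` that are not
images of lattice diagonal bonds (wrap-around bonds; absent when `x ↦ x mod L` is injective on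
`thicken Λ' 1`, cf. the tree's `diagHamiltonian_eq_fermionEmbed_localHamiltonian_add`).
[cite: BratteliRobinsonII1997, §6.2.1 (H_Λ' = H_Λ + W)] -/
theorem diagHamiltonian_eq_fermionEmbed_localHamiltonian_add_wrap {Λ' : Finset (Site 2)}
    (hInj : Set.InjOn (Torus.proj (d := 2) L) ↑Λ') :
    hamiltonian (fermionTorusDiagGraph L) t' 0 =
      fermionEmbed (PolySite.toTorusEmb L hInj) ((diagHoppingFermionInteraction t').localHamiltonian Λ') +
        (-(t' : ℂ) • ∑ a : FermionTorus 2 L, ∑ b : FermionTorus 2 L,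
            (if ¬(a ∈ Λ'.image (fun x => FermionTorus.ofTorusSite (Torus.proj L x)) ∧
                b ∈ Λ'.image (fun x => FermionTorus.ofTorusSite (Torus.proj L x))) then
              ∑ σ : Fin 2, (if (fermionTorusDiagGraph L).Adj a b then creation (orb a σ) * annihilation (orb b σ) else 0)
            else 0) +
          -(t' : ℂ) • ∑ x ∈ Λ', ∑ y ∈ Λ',
            (if (fermionTorusDiagGraph L).Adj (FermionTorus.ofTorusSite (Torus.proj L x))
                  (FermionTorus.ofTorusSite (Torus.proj L y)) ∧
                  ¬((∃ s : Fin 2, y = x + diagVec s) ∨ ∃ s : Fin 2, x = y + diagVec s) then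
              ∑ σ : Fin 2, creation (orb (FermionTorus.ofTorusSite (Torus.proj L x)) σ) *
                annihilation (orb (FermionTorus.ofTorusSite (Torus.proj L y)) σ)
            else 0)) := by
  have hι : Set.InjOn (fun x : Site 2 => FermionTorus.ofTorusSite (Torus.proj L x)) ↑Λ' :=
    injOn_ofTorusSite_proj L hInj
  rw [fermionEmbed_toTorusEmb_diag_localHamiltonian, hamiltonian, Complex.ofReal_zero, zero_smul, add_zero]
  -- split each term according to whether the bond lies in the image of `Λ'`
  have hsplit : ∀ a b : FermionTorus 2 L,
      (∑ σ : Fin 2, (if (fermionTorusDiagGraph L).Adj a b then creation (orb a σ) * annihilation (orb b σ) else 0)) =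
        (if a ∈ Λ'.image (fun x => FermionTorus.ofTorusSite (Torus.proj L x)) ∧
            b ∈ Λ'.image (fun x => FermionTorus.ofTorusSite (Torus.proj L x)) then
          ∑ σ : Fin 2, (if (fermionTorusDiagGraph L).Adj a b then creation (orb a σ) * annihilation (orb b σ) else 0)
          else 0) +
        (if ¬(a ∈ Λ'.image (fun x => FermionTorus.ofTorusSite (Torus.proj L x)) ∧
            b ∈ Λ'.image (fun x => FermionTorus.ofTorusSite (Torus.proj L x))) then
          ∑ σ : Fin 2, (if (fermionTorusDiagGraph L).Adj a b then creation (orb a σ) * annihilation (orb b σ) else 0)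
          else 0) := by
    intro a b
    by_cases hab : a ∈ Λ'.image (fun x => FermionTorus.ofTorusSite (Torus.proj L x)) ∧
        b ∈ Λ'.image (fun x => FermionTorus.ofTorusSite (Torus.proj L x))
    · rw [if_pos hab, if_neg (not_not.2 hab), add_zero]
    · rw [if_neg hab, if_pos hab, zero_add]
  -- a diagonal bond term between image sites is the image of a lattice diagonal bond term or a wrap-around term
  have hterm : ∀ x ∈ Λ', ∀ y ∈ Λ',
      (∑ σ : Fin 2, (if (fermionTorusDiagGraph L).Adj (FermionTorus.ofTorusSite (Torus.proj L x))
          (FermionTorus.ofTorusSite (Torus.proj L y)) then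
        creation (orb (FermionTorus.ofTorusSite (Torus.proj L x)) σ) *
          annihilation (orb (FermionTorus.ofTorusSite (Torus.proj L y)) σ) else 0)) =
        (if ((∃ s : Fin 2, y = x + diagVec s) ∨ ∃ s : Fin 2, x = y + diagVec s) then
            ∑ σ : Fin 2, creation (orb (FermionTorus.ofTorusSite (Torus.proj L x)) σ) *
              annihilation (orb (FermionTorus.ofTorusSite (Torus.proj L y)) σ) else 0) +
          (if (fermionTorusDiagGraph L).Adj (FermionTorus.ofTorusSite (Torus.proj L x))
                (FermionTorus.ofTorusSite (Torus.proj L y)) ∧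
                ¬((∃ s : Fin 2, y = x + diagVec s) ∨ ∃ s : Fin 2, x = y + diagVec s) then
            ∑ σ : Fin 2, creation (orb (FermionTorus.ofTorusSite (Torus.proj L x)) σ) *
              annihilation (orb (FermionTorus.ofTorusSite (Torus.proj L y)) σ) else 0) := by
    intro x hx y hy
    by_cases hxy : (∃ s : Fin 2, y = x + diagVec s) ∨ ∃ s : Fin 2, x = y + diagVec s
    · have hadj := fermionTorusDiagGraph_adj_proj_of_diagAdj L hInj hx hy hxy
      rw [if_pos hxy, if_neg (fun h => h.2 hxy), add_zero]
      exact Finset.sum_congr rfl fun σ _ => if_pos hadj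
    · rw [if_neg hxy, zero_add]
      by_cases hadj : (fermionTorusDiagGraph L).Adj (FermionTorus.ofTorusSite (Torus.proj L x))
          (FermionTorus.ofTorusSite (Torus.proj L y))
      · rw [if_pos ⟨hadj, hxy⟩]
        exact Finset.sum_congr rfl fun σ _ => if_pos hadj
      · rw [if_neg (fun h => hadj h.1)]
        exact Finset.sum_eq_zero fun σ _ => if_neg hadj
  -- the bonds inside the image
  have hin : ∑ a : FermionTorus 2 L, ∑ b : FermionTorus 2 L,
      (if a ∈ Λ'.image (fun x => FermionTorus.ofTorusSite (Torus.proj L x)) ∧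
          b ∈ Λ'.image (fun x => FermionTorus.ofTorusSite (Torus.proj L x)) then
        ∑ σ : Fin 2, (if (fermionTorusDiagGraph L).Adj a b then creation (orb a σ) * annihilation (orb b σ) else 0)
        else 0) =
      ∑ x ∈ Λ', ∑ y ∈ Λ', (if ((∃ s : Fin 2, y = x + diagVec s) ∨ ∃ s : Fin 2, x = y + diagVec s) then
          ∑ σ : Fin 2, creation (orb (FermionTorus.ofTorusSite (Torus.proj L x)) σ) *
            annihilation (orb (FermionTorus.ofTorusSite (Torus.proj L y)) σ) else 0) +
        ∑ x ∈ Λ', ∑ y ∈ Λ',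
          (if (fermionTorusDiagGraph L).Adj (FermionTorus.ofTorusSite (Torus.proj L x))
                (FermionTorus.ofTorusSite (Torus.proj L y)) ∧
                ¬((∃ s : Fin 2, y = x + diagVec s) ∨ ∃ s : Fin 2, x = y + diagVec s) then
            ∑ σ : Fin 2, creation (orb (FermionTorus.ofTorusSite (Torus.proj L x)) σ) *
              annihilation (orb (FermionTorus.ofTorusSite (Torus.proj L y)) σ) else 0) := by
    calc ∑ a : FermionTorus 2 L, ∑ b : FermionTorus 2 L,
          (if a ∈ Λ'.image (fun x => FermionTorus.ofTorusSite (Torus.proj L x)) ∧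
              b ∈ Λ'.image (fun x => FermionTorus.ofTorusSite (Torus.proj L x)) then
            ∑ σ : Fin 2, (if (fermionTorusDiagGraph L).Adj a b then creation (orb a σ) * annihilation (orb b σ) else 0)
            else 0)
        = ∑ a : FermionTorus 2 L, (if a ∈ Λ'.image (fun x => FermionTorus.ofTorusSite (Torus.proj L x)) then
            ∑ b ∈ Λ'.image (fun x => FermionTorus.ofTorusSite (Torus.proj L x)),
              ∑ σ : Fin 2, (if (fermionTorusDiagGraph L).Adj a b then creation (orb a σ) * annihilation (orb b σ) else 0)
            else 0) := by
          refine Finset.sum_congr rfl fun a _ => ?_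
          by_cases ha : a ∈ Λ'.image (fun x => FermionTorus.ofTorusSite (Torus.proj L x))
          · simp only [ha, true_and, if_true]
            rw [Finset.sum_ite_mem, Finset.univ_inter]
          · simp only [ha, false_and, if_false, Finset.sum_const_zero]
      _ = ∑ a ∈ Λ'.image (fun x => FermionTorus.ofTorusSite (Torus.proj L x)),
            ∑ b ∈ Λ'.image (fun x => FermionTorus.ofTorusSite (Torus.proj L x)),
              ∑ σ : Fin 2, (if (fermionTorusDiagGraph L).Adj a b then creation (orb a σ) * annihilation (orb b σ) else 0) := by
          rw [Finset.sum_ite_mem, Finset.univ_inter]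
      _ = ∑ x ∈ Λ', ∑ y ∈ Λ', ∑ σ : Fin 2,
            (if (fermionTorusDiagGraph L).Adj (FermionTorus.ofTorusSite (Torus.proj L x))
                (FermionTorus.ofTorusSite (Torus.proj L y)) then
              creation (orb (FermionTorus.ofTorusSite (Torus.proj L x)) σ) *
                annihilation (orb (FermionTorus.ofTorusSite (Torus.proj L y)) σ) else 0) := by
          rw [Finset.sum_image hι]
          exact Finset.sum_congr rfl fun x _ => Finset.sum_image hι
      _ = _ := by
          rw [← Finset.sum_add_distrib]
          refine Finset.sum_congr rfl fun x hx => ?_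
          rw [← Finset.sum_add_distrib]
          exact Finset.sum_congr rfl fun y hy => hterm x hx y hy
  have hhop : ∑ a : FermionTorus 2 L, ∑ b : FermionTorus 2 L, ∑ σ : Fin 2,
        (if (fermionTorusDiagGraph L).Adj a b then creation (orb a σ) * annihilation (orb b σ) else 0) =
      (∑ x ∈ Λ', ∑ y ∈ Λ', (if ((∃ s : Fin 2, y = x + diagVec s) ∨ ∃ s : Fin 2, x = y + diagVec s) then
          ∑ σ : Fin 2, creation (orb (FermionTorus.ofTorusSite (Torus.proj L x)) σ) *
            annihilation (orb (FermionTorus.ofTorusSite (Torus.proj L y)) σ) else 0) +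
        ∑ x ∈ Λ', ∑ y ∈ Λ',
          (if (fermionTorusDiagGraph L).Adj (FermionTorus.ofTorusSite (Torus.proj L x))
                (FermionTorus.ofTorusSite (Torus.proj L y)) ∧
                ¬((∃ s : Fin 2, y = x + diagVec s) ∨ ∃ s : Fin 2, x = y + diagVec s) then
            ∑ σ : Fin 2, creation (orb (FermionTorus.ofTorusSite (Torus.proj L x)) σ) *
              annihilation (orb (FermionTorus.ofTorusSite (Torus.proj L y)) σ) else 0)) +
        ∑ a : FermionTorus 2 L, ∑ b : FermionTorus 2 L,
            (if ¬(a ∈ Λ'.image (fun x => FermionTorus.ofTorusSite (Torus.proj L x)) ∧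
                b ∈ Λ'.image (fun x => FermionTorus.ofTorusSite (Torus.proj L x))) then
              ∑ σ : Fin 2, (if (fermionTorusDiagGraph L).Adj a b then creation (orb a σ) * annihilation (orb b σ) else 0)
            else 0) := by
    rw [← hin, ← Finset.sum_add_distrib]
    refine Finset.sum_congr rfl fun a _ => ?_
    rw [← Finset.sum_add_distrib]
    exact Finset.sum_congr rfl fun b _ => hsplit a b
  rw [hhop, smul_add, smul_add]
  abel

/-- **`H^{t'}_L - Γ(H^{t'}_{Λ'})` is even and far from `Λ`** under the sharp hypothesis: for `Λ ⊆ Λ'`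
with all four diagonal neighbours of every site of `Λ` in `Λ'` and `x ↦ x mod L` injective on `Λ'`, the
difference of the diagonal hopping Hamiltonian of the torus and the embedded local Hamiltonian of the
diagonal interaction on `Λ'` lies in the even CAR subalgebra of the orbitals away from the image of `Λ`
(far terms by the tree lemma `far_diag_hopping_mem_carEvenSubalgebra`; wrap-around diagonal bonds by
`wrapDiag_hopping_mem_carEvenSubalgebra`). [cite: BratteliRobinsonII1997, §6.2.1 and §5.2.2] -/
theorem diagHamiltonian_sub_fermionEmbed_localHamiltonian_mem_carEvenSubalgebra_sharp
    {Λ Λ' : Finset (Site 2)} (hΛ : Λ ⊆ Λ')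
    (hclosedD : ∀ x ∈ Λ, ∀ s : Fin 2, x + diagVec s ∈ Λ' ∧ x - diagVec s ∈ Λ')
    (hInj : Set.InjOn (Torus.proj (d := 2) L) ↑Λ') :
    hamiltonian (fermionTorusDiagGraph L) t' 0 -
        fermionEmbed (PolySite.toTorusEmb L hInj) ((diagHoppingFermionInteraction t').localHamiltonian Λ') ∈
      carEvenSubalgebra (orbs (Λ.image fun x => FermionTorus.ofTorusSite (Torus.proj L x)))ᶜ := by
  rw [diagHamiltonian_eq_fermionEmbed_localHamiltonian_add_wrap L t' hInj, add_sub_cancel_left]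
  exact add_mem (SMulMemClass.smul_mem _ (far_diag_hopping_mem_carEvenSubalgebra L hΛ hclosedD))
    (SMulMemClass.smul_mem _ (wrapDiag_hopping_mem_carEvenSubalgebra L hΛ hclosedD hInj))

/-- **`H^{tt'}_L - Γ(H^{tt'}_{Λ'})` is even and far from `Λ`** under the sharp hypothesis: if `Λ ⊆ Λ'`,
all eight king-move neighbours of every site of `Λ` lie in `Λ'` (`thicken Λ 1 ⊆ Λ'`) and `x ↦ x mod L`
is injective on `Λ'` (NOT necessarily on `thicken Λ' 1`), then the difference of the `t–t'` torus
Hamiltonian `hubbardTorusTT' L t t' U` and the embedded local Hamiltonian of the `t–t'` interaction on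
`Λ'` belongs to the even CAR subalgebra of the orbitals over the complement of the image of `Λ`
(nearest-neighbour part: pub-mbboot's `hubbardTorus_sub_fermionEmbed_localHamiltonian_mem_carEvenSubalgebra_sharp`;
diagonal part: `diagHamiltonian_sub_fermionEmbed_localHamiltonian_mem_carEvenSubalgebra_sharp`).
[cite: BratteliRobinsonII1997, §6.2.1 and §5.2.2] -/
theorem hubbardTorusTT'_sub_fermionEmbed_localHamiltonian_mem_carEvenSubalgebra_sharp
    {Λ Λ' : Finset (Site 2)} (hΛ : Λ ⊆ Λ') (h8 : thicken Λ 1 ⊆ Λ')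
    (hInj : Set.InjOn (Torus.proj (d := 2) L) ↑Λ') :
    hubbardTorusTT' L t t' U -
        fermionEmbed (PolySite.toTorusEmb L hInj) ((hubbardTTPrimeFermionInteraction t t' U).localHamiltonian Λ') ∈
      carEvenSubalgebra (orbs (Λ.image fun x => FermionTorus.ofTorusSite (Torus.proj L x)))ᶜ := by
  obtain ⟨hclosed, hclosedD⟩ := neighbours_mem_of_thicken_subset h8
  rw [hubbardTTPrimeFermionInteraction_localHamiltonian, fermionEmbed_add, hubbardTorusTT']
  have e : hamiltonian (fermionTorusGraph 2 L) t U + hamiltonian (fermionTorusDiagGraph L) t' 0 -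
      (fermionEmbed (PolySite.toTorusEmb L hInj) ((hubbardFermionInteraction 2 t U).localHamiltonian Λ') +
        fermionEmbed (PolySite.toTorusEmb L hInj) ((diagHoppingFermionInteraction t').localHamiltonian Λ')) =
      (hubbardTorus 2 L t U -
          fermionEmbed (PolySite.toTorusEmb L hInj) ((hubbardFermionInteraction 2 t U).localHamiltonian Λ')) +
        (hamiltonian (fermionTorusDiagGraph L) t' 0 -
          fermionEmbed (PolySite.toTorusEmb L hInj) ((diagHoppingFermionInteraction t').localHamiltonian Λ')) := by
    rw [hubbardTorus]
    abel
  rw [e]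
  exact add_mem (hubbardTorus_sub_fermionEmbed_localHamiltonian_mem_carEvenSubalgebra_sharp L t U hΛ hclosed hInj)
    (diagHamiltonian_sub_fermionEmbed_localHamiltonian_mem_carEvenSubalgebra_sharp L t' hΛ hclosedD hInj)

/-- **Graded locality on the torus** (sharp hypothesis): `H^{tt'}_L - Γ(H^{tt'}_{Λ'})` commutes with
every embedded observable of `Λ`. [cite: BratteliRobinsonII1997, §5.2.2] -/
theorem commute_hubbardTorusTT'_sub_fermionEmbed_localHamiltonian_sharp {Λ Λ' : Finset (Site 2)}
    (hΛ : Λ ⊆ Λ') (h8 : thicken Λ 1 ⊆ Λ')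
    (hInj : Set.InjOn (Torus.proj (d := 2) L) ↑Λ') (A : FermionOp Λ) :
    Commute (hubbardTorusTT' L t t' U -
        fermionEmbed (PolySite.toTorusEmb L hInj) ((hubbardTTPrimeFermionInteraction t t' U).localHamiltonian Λ'))
      (fermionEmbed (PolySite.toTorusEmb L hInj) (fermionEmbed (PolySite.incl hΛ) A)) := by
  rw [fermionEmbed_fermionEmbed]
  refine commute_of_mem_carEvenSubalgebra
    (hubbardTorusTT'_sub_fermionEmbed_localHamiltonian_mem_carEvenSubalgebra_sharp L t t' U hΛ h8 hInj)
    (fermionEmbed_mem_carSubalgebra _ A) ?_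
  exact disjoint_compl_left_iff.2 (orbs_map_incl_trans_toTorusEmb_subset L hΛ _)

/-- **The commutator with the `t–t'` torus Hamiltonian is the embedded local commutator — sharp torus
hypothesis.** For an observable `A` of `Λ`, embedded into the torus through `Λ' ⊇ thicken Λ 1`
(`x ↦ x mod L` injective on `Λ'` — NOT necessarily on `thicken Λ' 1`),
`[H^{tt'}_L, Γ A] = Γ([H^{tt'}_{Λ'}, A])`; the tree's `hubbardTorusTT'_commutator_fermionEmbed` is the
special case of an injectivity hypothesis on `thicken Λ' 1` (for a window of coordinate spread `M`:
`L ≥ M + 1` here versus `L ≥ M + 3` there). Bratteli–Robinson II Thm. 6.2.4 on the torus, `t–t'` model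
of Xu et al. (2024) eq. (1). [cite: BratteliRobinsonII1997, Thm. 6.2.4] -/
theorem hubbardTorusTT'_commutator_fermionEmbed_sharp {Λ Λ' : Finset (Site 2)}
    (hΛ : Λ ⊆ Λ') (h8 : thicken Λ 1 ⊆ Λ')
    (hInj : Set.InjOn (Torus.proj (d := 2) L) ↑Λ') (A : FermionOp Λ) :
    hubbardTorusTT' L t t' U * fermionEmbed (PolySite.toTorusEmb L hInj) (fermionEmbed (PolySite.incl hΛ) A) -
        fermionEmbed (PolySite.toTorusEmb L hInj) (fermionEmbed (PolySite.incl hΛ) A) * hubbardTorusTT' L t t' U =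
      fermionEmbed (PolySite.toTorusEmb L hInj)
        ((hubbardTTPrimeFermionInteraction t t' U).localHamiltonian Λ' * fermionEmbed (PolySite.incl hΛ) A -
          fermionEmbed (PolySite.incl hΛ) A * (hubbardTTPrimeFermionInteraction t t' U).localHamiltonian Λ') := by
  have hc := commute_hubbardTorusTT'_sub_fermionEmbed_localHamiltonian_sharp L t t' U hΛ h8 hInj A
  rw [Commute, SemiconjBy, sub_mul, mul_sub, sub_eq_sub_iff_sub_eq_sub] at hc
  rw [fermionEmbed_sub, fermionEmbed_mul, fermionEmbed_mul]
  exact hc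

end Decomposition

end Summit.Ventures.CertifiedManyBodySolver.Rows

end
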